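import Summits.HodgeConjecture.HodgeConjecture.Theorems.F0P3cStCharTSUpTrEmbFamily   -- ★ (N2b′) p852417 (F0P3a-p08): `exists_embFamily` (S, e, (i)–(vi)); brings ★ `IsLocalNormPair.isRegularElt`, ★ G-side Cartan facts
import Literature.GroupTheory.CentralizerConjugatesTorsor                                -- ★ (H6-T)-generic torsor `exists_finset_mem_isConj_card_eq_index`
import HarnessLib

/-!
# F0 · P3c · ROAD «UP-TR» (A1′) carve (X2) «ψ FROM e»: the embedding family `ψ_{T,i} : T → G` of an `H`-Cartan subgroup, its norm-pair, uniqueness and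
# finite-fibre letters, from the per-class isomorphisms `e : Z_H(γ₀) ≃ Z_G(γ)` (Rogawski 1990 §12.5 pp. 182–183; Langlands–Shelstad 1987 §1.3)

Cell `pub/hodgecm-mathlib`, crux H413 = `stmt-HodgeConjecture-24833` (lane `--supports … --as helper`); seat LH10-p02 (g10), co-hand of (A1′) «UP-TR ASSEMBLY»
(pen LH10-p01 (g8), CENSUS (A1′) 42cf0f1d §2 carve (X2); holder F0P3-p02 (g23) 2026-09-02T19:13:15Z).  THEOREMS ONLY; sorry-free; no definition ∕ instance ∕ notation ∕
named fact; ★-only imports; axioms TRIO.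

WHAT.  ★ (N2b′) `exists_embFamily` gives, at each `G`-regular `γ₀ ∈ H_v`, a finite set `S ⊂ G = U(Φ₃)(L⁺_v)` of pairwise non-conjugate regular matches of `γ₀` and isomorphisms
`e γ : Z_H(γ₀) ≃ₜ* Z_G(γ)` (`γ ∈ S`) with pointwise matching, exhaustion and injectivity along the torus.  This file repackages that datum in the letters of ★ (P3)
`…UpTrClaimP.finsum_upSummand_eq_weightedSum` (binders `n ψ hψR hψuniq fib hfib`) for a whole finite family `SH` of `H`-Cartan subgroups:
* §1 **`exists_psi_at`** — ONE Cartan `T = Z_H(γ₀)`: `k := |S|`, an enumeration `Fin k ≃ S`, `ψ i x := (e γ_i ⟨x, _⟩).1` on `T` (and `1` off `T`), with: `γ i` regular; the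
  realisation `ψ i x = (e i x).1`; the norm-pair letter along `e i`; the `G`-Cartan letter `Z_G((e i s).1) = Z_G(γ i)`; (P3)'s `hψR`; (P3)'s `hψuniq` (existence = exhaustion
  (iii), uniqueness = injectivity (iv)); FINITENESS of every fibre `{x ∈ T | x G-regular, ψ i x ∼ g}` (it embeds, through the injective `x ↦ (e i x).1`, into the set of
  conjugates of one regular element inside the `G`-Cartan `Z_G(γ i)` — finite by the ★ torsor lemma with ★ `centralizer_eq_cartan_of_isRegularElt`, ★
  `isRegularElt_conj_val_iff`, ★ WEYL-FIN).
* §2 **`exists_psi_of_embFamily`** — the family over `SH` by ONE `choose` (no dependent `dite` in the data the consumer sees): `n`, `γ`, `e`, `ψ` and the `Finset`-valued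
  `fib g T i` (a function of `g`, as the (A1′) pen integrates over `g`) with (P3)'s `hfib` membership letter, plus (P3)'s `hψR`, `hψuniq` token for token.

HONEST LABEL: count-neutral; closes no organ.  HC_CM is proved only modulo the 7 printed citations (2 remaining: hLiu418 = `stmt-HodgeConjecture-24832`,
h413 = `stmt-HodgeConjecture-24833`) until rung 0 closes.

## References
* [Rogawski1990] J. D. Rogawski, *Automorphic Representations of Unitary Groups in Three Variables*, Ann. of Math. Stud. 123 (1990), §12.5 pp. 182–183; §3.6 p. 28.
* [LanglandsShelstad1987] R. P. Langlands, D. Shelstad, *On the definition of transfer factors*, Math. Ann. 278 (1987), §1.3.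
* [HarishChandra1970] Harish-Chandra (notes by G. van Dijk), *Harmonic analysis on reductive p-adic groups*, LNM 162 (1970), Lemma 42.
-/

set_option autoImplicit false
-- the mandated namespace has the single-problem summit's repeated segment (`HodgeConjecture.HodgeConjecture`)
set_option linter.dupNamespace false

noncomputable section

open MeasureTheory Set Filter Topology Function NumberField IsDedekindDomain
open Literature.NumberTheory.Automorphic Literature.NumberTheory.Automorphic.UnitaryGroup Literature.NumberTheory.Rogawski1990
open Summit.HodgeConjecture.HodgeConjecture.Cruxes.H413.F0P3cStCharTSUpTrEmbFamily
open Summit.HodgeConjecture.HodgeConjecture.Cruxes.H413.F0P3cStCharTSWeylCartanRadial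
open scoped MatrixGroups Classical

namespace Summit.HodgeConjecture.HodgeConjecture.Cruxes.H413.F0P3cStCharTSUpTrPsiOfEmb

section CM

variable (L : Type) [Field L] [NumberField L] [IsCMField L] (v : HeightOneSpectrum (𝓞 ↥(maximalRealSubfield L)))

/-! ## §1 One `H`-Cartan subgroup -/

/-- **(X2) at ONE Cartan subgroup `T = Z_H(γ₀)`** (`γ₀` `G`-regular, `v` non-split): the enumeration of ★ (N2b′)'s class set `S`, the embeddings `e i : T ≃ₜ* Z_G(γ i)`, the
maps `ψ i : H_v → G` (`= (e i ·).1` on `T`), and the seven letters — regularity of `γ i`, realisation, norm pairs along `e i`, the `G`-Cartan of `(e i s).1`, (P3)'s `hψR`,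
(P3)'s `hψuniq`, finiteness of the fibres `{x ∈ T | x G-regular, ψ i x ∼ g}`. [cite: Rogawski1990, §12.5 pp. 182–183] [cite: LanglandsShelstad1987, §1.3] -/
theorem exists_psi_at (hns : ∀ w : PlacesOver L v, IsCMField.complexConj L • w.1 = w.1)
    {T : Subgroup ((UnitaryGroup.cmDatum L 2 (Matrix.of fun i j : Fin 2 => if i.val + j.val + 1 = 2 then (1 : L) else 0)).Local v × (UnitaryGroup.cmDatum L 1 (Matrix.of fun i j : Fin 1 => if i.val + j.val + 1 = 1 then (1 : L) else 0)).Local v)} {γ₀ : ((UnitaryGroup.cmDatum L 2 (Matrix.of fun i j : Fin 2 => if i.val + j.val + 1 = 2 then (1 : L) else 0)).Local v × (UnitaryGroup.cmDatum L 1 (Matrix.of fun i j : Fin 1 => if i.val + j.val + 1 = 1 then (1 : L) else 0)).Local v)} (hreg : IsLocalGRegular L v γ₀) (hT : T = Subgroup.centralizer ({γ₀} : Set ((UnitaryGroup.cmDatum L 2 (Matrix.of fun i j : Fin 2 => if i.val + j.val + 1 = 2 then (1 : L) else 0)).Local v × (UnitaryGroup.cmDatum L 1 (Matrix.of fun i j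 : Fin 1 => if i.val + j.val + 1 = 1 then (1 : L) else 0)).Local v))) :
    ∃ (k : ℕ) (γ : Fin k → Gqs L v) (e : (i : Fin k) → (↥T ≃ₜ* ↥(Subgroup.centralizer ({γ i} : Set (Gqs L v))))) (ψ : Fin k → ((UnitaryGroup.cmDatum L 2 (Matrix.of fun i j : Fin 2 => if i.val + j.val + 1 = 2 then (1 : L) else 0)).Local v × (UnitaryGroup.cmDatum L 1 (Matrix.of fun i j : Fin 1 => if i.val + j.val + 1 = 1 then (1 : L) else 0)).Local v) → Gqs L v),
      (∀ i, IsRegularElt ((γ i).val : GL (Fin 3) (UnitaryGroup.LocalRing L v))) ∧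
      (∀ i (x : ↥T), ψ i x = ((e i x : ↥(Subgroup.centralizer ({γ i} : Set (Gqs L v)))) : Gqs L v)) ∧
      (∀ i (s : ↥T), IsLocalNormPair L (qsForm L) v (s : ((UnitaryGroup.cmDatum L 2 (Matrix.of fun i j : Fin 2 => if i.val + j.val + 1 = 2 then (1 : L) else 0)).Local v × (UnitaryGroup.cmDatum L 1 (Matrix.of fun i j : Fin 1 => if i.val + j.val + 1 = 1 then (1 : L) else 0)).Local v)) ((e i s : ↥(Subgroup.centralizer ({γ i} : Set (Gqs L v)))) : Gqs L v)) ∧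
      (∀ i (s : ↥T), IsLocalGRegular L v (s : ((UnitaryGroup.cmDatum L 2 (Matrix.of fun i j : Fin 2 => if i.val + j.val + 1 = 2 then (1 : L) else 0)).Local v × (UnitaryGroup.cmDatum L 1 (Matrix.of fun i j : Fin 1 => if i.val + j.val + 1 = 1 then (1 : L) else 0)).Local v)) →
        Subgroup.centralizer ({((e i s : ↥(Subgroup.centralizer ({γ i} : Set (Gqs L v)))) : Gqs L v)} : Set (Gqs L v)) = Subgroup.centralizer ({γ i} : Set (Gqs L v))) ∧
      (∀ i, ∀ s ∈ T, IsLocalGRegular L v s → IsLocalNormPair L (qsForm L) v s (ψ i s)) ∧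
      (∀ s ∈ T, IsLocalGRegular L v s → ∀ g : Gqs L v, IsLocalNormPair L (qsForm L) v s g → ∃! i : Fin k, IsConj (ψ i s) g) ∧
      (∀ (g : Gqs L v) (i : Fin k), Set.Finite {x : ((UnitaryGroup.cmDatum L 2 (Matrix.of fun i j : Fin 2 => if i.val + j.val + 1 = 2 then (1 : L) else 0)).Local v × (UnitaryGroup.cmDatum L 1 (Matrix.of fun i j : Fin 1 => if i.val + j.val + 1 = 1 then (1 : L) else 0)).Local v) | x ∈ T ∧ IsLocalGRegular L v x ∧ IsConj (ψ i x) g}) := by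
  subst hT
  obtain ⟨S, e, h1, h2, h3, h4, h5, h6, h7, h8⟩ := exists_embFamily L v hns γ₀ hreg
  set k : ℕ := S.card with hk
  let σ : Fin k ≃ {x // x ∈ S} := S.equivFin.symm
  let ψ : Fin k → ((UnitaryGroup.cmDatum L 2 (Matrix.of fun i j : Fin 2 => if i.val + j.val + 1 = 2 then (1 : L) else 0)).Local v × (UnitaryGroup.cmDatum L 1 (Matrix.of fun i j : Fin 1 => if i.val + j.val + 1 = 1 then (1 : L) else 0)).Local v) → Gqs L v := fun i x =>
    if hx : x ∈ Subgroup.centralizer ({γ₀} : Set ((UnitaryGroup.cmDatum L 2 (Matrix.of fun i j : Fin 2 => if i.val + j.val + 1 = 2 then (1 : L) else 0)).Local v × (UnitaryGroup.cmDatum L 1 (Matrix.of fun i j : Fin 1 => if i.val + j.val + 1 = 1 then (1 : L) else 0)).Local v)) then ((e (σ i).1 (σ i).2 ⟨x, hx⟩ : ↥(Subgroup.centralizer ({((σ i).1 : Gqs L v)} : Set (Gqs L v)))) : Gqs L v) else 1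
  have hψ_def : ∀ i x (hx : x ∈ Subgroup.centralizer ({γ₀} : Set ((UnitaryGroup.cmDatum L 2 (Matrix.of fun i j : Fin 2 => if i.val + j.val + 1 = 2 then (1 : L) else 0)).Local v × (UnitaryGroup.cmDatum L 1 (Matrix.of fun i j : Fin 1 => if i.val + j.val + 1 = 1 then (1 : L) else 0)).Local v))),
      ψ i x = ((e (σ i).1 (σ i).2 ⟨x, hx⟩ : ↥(Subgroup.centralizer ({((σ i).1 : Gqs L v)} : Set (Gqs L v)))) : Gqs L v) := by
    intro i x hx
    simp only [ψ, dif_pos hx]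
  refine ⟨k, fun i => (σ i).1, fun i => e (σ i).1 (σ i).2, ψ, ?_, ?_, ?_, ?_, ?_, ?_, ?_⟩
  · intro i
    exact (h1 _ (σ i).2).2
  · intro i x
    rw [hψ_def i x x.2]
  · intro i s
    exact h5 _ (σ i).2 s
  · intro i s hs
    exact h8 _ (σ i).2 s hs
  · intro i s hs hsreg
    rw [hψ_def i s hs]
    exact h5 _ (σ i).2 ⟨s, hs⟩
  · intro s hs hsreg g hg
    obtain ⟨γc, hc, hconj⟩ := h3 ⟨s, hs⟩ hsreg g hg
    refine ⟨σ.symm ⟨γc, hc⟩, ?_, ?_⟩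
    · change IsConj (ψ (σ.symm ⟨γc, hc⟩) s) g
      rw [hψ_def _ s hs]
      have key : ∀ a : {x // x ∈ S}, a = ⟨γc, hc⟩ →
          IsConj ((e a.1 a.2 ⟨s, hs⟩ : ↥(Subgroup.centralizer ({(a.1 : Gqs L v)} : Set (Gqs L v)))) : Gqs L v) g := by
        rintro a rfl; exact hconj
      exact key _ (σ.apply_symm_apply _)
    · intro j hj
      change IsConj (ψ j s) g at hj
      rw [hψ_def j s hs] at hj
      by_contra hne
      have hne' : ((σ j).1 : Gqs L v) ≠ γc := by
        intro h
        apply hne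
        rw [Equiv.eq_symm_apply]
        exact Subtype.ext h
      exact h4 ⟨s, hs⟩ hsreg (σ j).1 (σ j).2 γc hc hne' (hj.trans hconj.symm)
  · intro g i
    by_cases hne : ({x : ((UnitaryGroup.cmDatum L 2 (Matrix.of fun i j : Fin 2 => if i.val + j.val + 1 = 2 then (1 : L) else 0)).Local v × (UnitaryGroup.cmDatum L 1 (Matrix.of fun i j : Fin 1 => if i.val + j.val + 1 = 1 then (1 : L) else 0)).Local v) | x ∈ Subgroup.centralizer ({γ₀} : Set ((UnitaryGroup.cmDatum L 2 (Matrix.of fun i j : Fin 2 => if i.val + j.val + 1 = 2 then (1 : L) else 0)).Local v × (UnitaryGroup.cmDatum L 1 (Matrix.of fun i j : Fin 1 => if i.val + j.val + 1 = 1 then (1 : L) else 0)).Local v)) ∧ IsLocalGRegular L v x ∧ IsConj (ψ i x) g}).Nonempty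
    · obtain ⟨x₀, hx₀T, hx₀reg, hx₀conj⟩ := hne
      -- the `G`-Cartan `T' = Z_G(γ_i)` and the regular point `s' := (e_i x₀).1 ∈ T'`
      set γi : Gqs L v := (σ i).1 with hγi
      have hγireg : IsRegularElt (γi.val : GL (Fin 3) (UnitaryGroup.LocalRing L v)) := (h1 _ (σ i).2).2
      set s' : ↥(Subgroup.centralizer ({γi} : Set (Gqs L v))) := e (σ i).1 (σ i).2 ⟨x₀, hx₀T⟩ with hs'
      have hs'reg : IsRegularElt (((s' : Gqs L v)).val : GL (Fin 3) (UnitaryGroup.LocalRing L v)) :=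
        IsLocalNormPair.isRegularElt L (qsForm L) v hx₀reg (h5 _ (σ i).2 ⟨x₀, hx₀T⟩)
      -- the torsor: the conjugates of `s'` inside `T'` form a finite set
      obtain ⟨A, hA, -⟩ := Literature.GroupTheory.exists_finset_mem_isConj_card_eq_index (Subgroup.centralizer ({γi} : Set (Gqs L v)))
        {y : Gqs L v | IsRegularElt (y.val : GL (Fin 3) (UnitaryGroup.LocalRing L v))}
        (fun t ht => centralizer_eq_cartan_of_isRegularElt hγireg rfl t ht)
        (fun g' y hy => (isRegularElt_conj_val_iff L v g' y).2 hy)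
        (index_cartan_subgroupOf_normalizer_ne_zero hγireg rfl hns) s'.2 hs'reg
      -- the fibre embeds into `A` through the injective `x ↦ ψ i x`
      refine Set.Finite.of_finite_image (f := ψ i) ((A.finite_toSet).subset ?_) ?_
      · rintro y ⟨x, ⟨hxT, hxreg, hxconj⟩, rfl⟩
        rw [Finset.mem_coe, hA]
        refine ⟨?_, ?_⟩
        · rw [hψ_def i x hxT]
          exact (e (σ i).1 (σ i).2 ⟨x, hxT⟩).2
        · have h0 : IsConj (ψ i x₀) g := hx₀conj
          rw [hψ_def i x₀ hx₀T] at h0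
          exact h0.trans hxconj.symm
      · rintro x ⟨hxT, -, -⟩ y ⟨hyT, -, -⟩ hxy
        rw [hψ_def i x hxT, hψ_def i y hyT] at hxy
        have hxy' := (e (σ i).1 (σ i).2).injective (Subtype.ext hxy)
        exact congrArg Subtype.val hxy'
    · rw [Set.not_nonempty_iff_eq_empty] at hne
      rw [hne]
      exact Set.finite_empty

/-! ## §2 The family over a finite set `SH` of `H`-Cartan subgroups — (P3)'s letters `n ψ hψR hψuniq fib hfib` -/

/-- **(X2) «ψ FROM e» — THE PACKAGE.**  For a finite family `SH` of `H`-Cartan subgroups `T = Z_H(γ₀)` (`γ₀` `G`-regular; the (H1) letter `hZ`), there are `n : Subgroup H_v → ℕ`,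
`γ T i ∈ G` regular, `e T i : T ≃ₜ* Z_G(γ T i)`, `ψ T i : H_v → G` realised by `e T i` on `T`, with norm pairs along `e T i`, the `G`-Cartan letter, (P3)'s `hψR`, (P3)'s `hψuniq`, and for every
`g ∈ G` Finsets `fib g T i` with (P3)'s membership letter `x ∈ fib g T i ↔ x ∈ T ∧ x G-regular ∧ ψ T i x ∼ g`. [cite: Rogawski1990, §12.5 pp. 182–183, Lemma 12.5.1] [cite: LanglandsShelstad1987, §1.3] -/
theorem exists_psi_of_embFamily (hns : ∀ w : PlacesOver L v, IsCMField.complexConj L • w.1 = w.1)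
    (SH : Finset (Subgroup ((UnitaryGroup.cmDatum L 2 (Matrix.of fun i j : Fin 2 => if i.val + j.val + 1 = 2 then (1 : L) else 0)).Local v × (UnitaryGroup.cmDatum L 1 (Matrix.of fun i j : Fin 1 => if i.val + j.val + 1 = 1 then (1 : L) else 0)).Local v)))
    (hZ : ∀ T ∈ SH, ∃ γ₀ : ((UnitaryGroup.cmDatum L 2 (Matrix.of fun i j : Fin 2 => if i.val + j.val + 1 = 2 then (1 : L) else 0)).Local v × (UnitaryGroup.cmDatum L 1 (Matrix.of fun i j : Fin 1 => if i.val + j.val + 1 = 1 then (1 : L) else 0)).Local v), IsLocalGRegular L v γ₀ ∧ T = Subgroup.centralizer ({γ₀} : Set ((UnitaryGroup.cmDatum L 2 (Matrix.of fun i j : Fin 2 => if i.val + j.val + 1 = 2 then (1 : L) else 0)).Local v × (UnitaryGroup.cmDatum L 1 (Matrix.of fun i j : Fin 1 => if i.val + j.val + 1 = 1 then (1 : L) else 0)).Local v))) :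
    ∃ (n : Subgroup ((UnitaryGroup.cmDatum L 2 (Matrix.of fun i j : Fin 2 => if i.val + j.val + 1 = 2 then (1 : L) else 0)).Local v × (UnitaryGroup.cmDatum L 1 (Matrix.of fun i j : Fin 1 => if i.val + j.val + 1 = 1 then (1 : L) else 0)).Local v) → ℕ) (γ : (T : Subgroup ((UnitaryGroup.cmDatum L 2 (Matrix.of fun i j : Fin 2 => if i.val + j.val + 1 = 2 then (1 : L) else 0)).Local v × (UnitaryGroup.cmDatum L 1 (Matrix.of fun i j : Fin 1 => if i.val + j.val + 1 = 1 then (1 : L) else 0)).Local v)) → Fin (n T) → Gqs L v)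
      (e : (T : Subgroup ((UnitaryGroup.cmDatum L 2 (Matrix.of fun i j : Fin 2 => if i.val + j.val + 1 = 2 then (1 : L) else 0)).Local v × (UnitaryGroup.cmDatum L 1 (Matrix.of fun i j : Fin 1 => if i.val + j.val + 1 = 1 then (1 : L) else 0)).Local v)) → (i : Fin (n T)) → (↥T ≃ₜ* ↥(Subgroup.centralizer ({γ T i} : Set (Gqs L v)))))
      (ψ : (T : Subgroup ((UnitaryGroup.cmDatum L 2 (Matrix.of fun i j : Fin 2 => if i.val + j.val + 1 = 2 then (1 : L) else 0)).Local v × (UnitaryGroup.cmDatum L 1 (Matrix.of fun i j : Fin 1 => if i.val + j.val + 1 = 1 then (1 : L) else 0)).Local v)) → Fin (n T) → ((UnitaryGroup.cmDatum L 2 (Matrix.of fun i j : Fin 2 => if i.val + j.val + 1 = 2 then (1 : L) else 0)).Local v × (UnitaryGroup.cmDatum L 1 (Matrix.of fun i j : Fin 1 => if i.val + j.val + 1 = 1 then (1 : L) else 0)).Local v) → Gqs L v) (fib : Gqs L v → (T : Subgroup ((UnitaryGroup.cmDatum L 2 (Matrix.of fun i j : Fin 2 => if i.val + j.val + 1 =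 2 then (1 : L) else 0)).Local v × (UnitaryGroup.cmDatum L 1 (Matrix.of fun i j : Fin 1 => if i.val + j.val + 1 = 1 then (1 : L) else 0)).Local v)) → Fin (n T) → Finset ((UnitaryGroup.cmDatum L 2 (Matrix.of fun i j : Fin 2 => if i.val + j.val + 1 = 2 then (1 : L) else 0)).Local v × (UnitaryGroup.cmDatum L 1 (Matrix.of fun i j : Fin 1 => if i.val + j.val + 1 = 1 then (1 : L) else 0)).Local v)),
      (∀ T ∈ SH, ∀ i, IsRegularElt ((γ T i).val : GL (Fin 3) (UnitaryGroup.LocalRing L v))) ∧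
      (∀ T ∈ SH, ∀ i (x : ↥T), ψ T i x = ((e T i x : ↥(Subgroup.centralizer ({γ T i} : Set (Gqs L v)))) : Gqs L v)) ∧
      (∀ T ∈ SH, ∀ i (s : ↥T), IsLocalNormPair L (qsForm L) v (s : ((UnitaryGroup.cmDatum L 2 (Matrix.of fun i j : Fin 2 => if i.val + j.val + 1 = 2 then (1 : L) else 0)).Local v × (UnitaryGroup.cmDatum L 1 (Matrix.of fun i j : Fin 1 => if i.val + j.val + 1 = 1 then (1 : L) else 0)).Local v)) ((e T i s : ↥(Subgroup.centralizer ({γ T i} : Set (Gqs L v)))) : Gqs L v)) ∧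
      (∀ T ∈ SH, ∀ i (s : ↥T), IsLocalGRegular L v (s : ((UnitaryGroup.cmDatum L 2 (Matrix.of fun i j : Fin 2 => if i.val + j.val + 1 = 2 then (1 : L) else 0)).Local v × (UnitaryGroup.cmDatum L 1 (Matrix.of fun i j : Fin 1 => if i.val + j.val + 1 = 1 then (1 : L) else 0)).Local v)) →
        Subgroup.centralizer ({((e T i s : ↥(Subgroup.centralizer ({γ T i} : Set (Gqs L v)))) : Gqs L v)} : Set (Gqs L v)) = Subgroup.centralizer ({γ T i} : Set (Gqs L v))) ∧
      (∀ T ∈ SH, ∀ (i : Fin (n T)), ∀ s ∈ T, IsLocalGRegular L v s → IsLocalNormPair L (qsForm L) v s (ψ T i s)) ∧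
      (∀ T ∈ SH, ∀ s ∈ T, IsLocalGRegular L v s → ∀ g : Gqs L v, IsLocalNormPair L (qsForm L) v s g → ∃! i : Fin (n T), IsConj (ψ T i s) g) ∧
      (∀ g : Gqs L v, ∀ T ∈ SH, ∀ (i : Fin (n T)), ∀ x, x ∈ fib g T i ↔ x ∈ T ∧ IsLocalGRegular L v x ∧ IsConj (ψ T i x) g) := by
  have key : ∀ T : Subgroup ((UnitaryGroup.cmDatum L 2 (Matrix.of fun i j : Fin 2 => if i.val + j.val + 1 = 2 then (1 : L) else 0)).Local v × (UnitaryGroup.cmDatum L 1 (Matrix.of fun i j : Fin 1 => if i.val + j.val + 1 = 1 then (1 : L) else 0)).Local v), ∃ (k : ℕ) (γ : Fin k → Gqs L v) (e : (i : Fin k) → (↥T ≃ₜ* ↥(Subgroup.centralizer ({γ i} : Set (Gqs L v)))))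
      (ψ : Fin k → ((UnitaryGroup.cmDatum L 2 (Matrix.of fun i j : Fin 2 => if i.val + j.val + 1 = 2 then (1 : L) else 0)).Local v × (UnitaryGroup.cmDatum L 1 (Matrix.of fun i j : Fin 1 => if i.val + j.val + 1 = 1 then (1 : L) else 0)).Local v) → Gqs L v), T ∈ SH →
      ((∀ i, IsRegularElt ((γ i).val : GL (Fin 3) (UnitaryGroup.LocalRing L v))) ∧
      (∀ i (x : ↥T), ψ i x = ((e i x : ↥(Subgroup.centralizer ({γ i} : Set (Gqs L v)))) : Gqs L v)) ∧
      (∀ i (s : ↥T), IsLocalNormPair L (qsForm L) v (s : ((UnitaryGroup.cmDatum L 2 (Matrix.of fun i j : Fin 2 => if i.val + j.val + 1 = 2 then (1 : L) else 0)).Local v × (UnitaryGroup.cmDatum L 1 (Matrix.of fun i j : Fin 1 => if i.val + j.val + 1 = 1 then (1 : L) else 0)).Local v)) ((e i s : ↥(Subgroup.centralizer ({γ i} : Set (Gqs L v)))) : Gqs L v)) ∧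
      (∀ i (s : ↥T), IsLocalGRegular L v (s : ((UnitaryGroup.cmDatum L 2 (Matrix.of fun i j : Fin 2 => if i.val + j.val + 1 = 2 then (1 : L) else 0)).Local v × (UnitaryGroup.cmDatum L 1 (Matrix.of fun i j : Fin 1 => if i.val + j.val + 1 = 1 then (1 : L) else 0)).Local v)) →
        Subgroup.centralizer ({((e i s : ↥(Subgroup.centralizer ({γ i} : Set (Gqs L v)))) : Gqs L v)} : Set (Gqs L v)) = Subgroup.centralizer ({γ i} : Set (Gqs L v))) ∧
      (∀ i, ∀ s ∈ T, IsLocalGRegular L v s → IsLocalNormPair L (qsForm L) v s (ψ i s)) ∧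
      (∀ s ∈ T, IsLocalGRegular L v s → ∀ g : Gqs L v, IsLocalNormPair L (qsForm L) v s g → ∃! i : Fin k, IsConj (ψ i s) g) ∧
      (∀ (g : Gqs L v) (i : Fin k), Set.Finite {x : ((UnitaryGroup.cmDatum L 2 (Matrix.of fun i j : Fin 2 => if i.val + j.val + 1 = 2 then (1 : L) else 0)).Local v × (UnitaryGroup.cmDatum L 1 (Matrix.of fun i j : Fin 1 => if i.val + j.val + 1 = 1 then (1 : L) else 0)).Local v) | x ∈ T ∧ IsLocalGRegular L v x ∧ IsConj (ψ i x) g})) := by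
    intro T
    by_cases hT : T ∈ SH
    · obtain ⟨γ₀, hreg, hTeq⟩ := hZ T hT
      obtain ⟨k, γ, e, ψ, h⟩ := exists_psi_at L v hns hreg hTeq
      exact ⟨k, γ, e, ψ, fun _ => h⟩
    · exact ⟨0, Fin.elim0, fun i => Fin.elim0 i, fun i => Fin.elim0 i, fun h => absurd h hT⟩
  choose n γ e ψ hpkg using key
  refine ⟨n, γ, e, ψ, fun g T i => if hT : T ∈ SH then ((hpkg T hT).2.2.2.2.2.2 g i).toFinset else ∅,
    fun T hT => (hpkg T hT).1, fun T hT => (hpkg T hT).2.1, fun T hT => (hpkg T hT).2.2.1, fun T hT => (hpkg T hT).2.2.2.1,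
    fun T hT => (hpkg T hT).2.2.2.2.1, fun T hT => (hpkg T hT).2.2.2.2.2.1, fun g T hT i x => ?_⟩
  dsimp only
  rw [dif_pos hT, Set.Finite.mem_toFinset]
  rfl

end CM

end Summit.HodgeConjecture.HodgeConjecture.Cruxes.H413.F0P3cStCharTSUpTrPsiOfEmb

end
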